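import Literature.Computability.Cryptography.ZhandryOracle
import Literature.Barriers.QuantumAdvantage.PPolyOraclesPPoly
import HarnessLib

/-!
# Aaronson–Chen 2017, Thm. 7.6: the oracle `zhandryOracle F ℓ C` is in `P/poly` — discharged

Sibling proof file of `Literature/Computability/Cryptography/ZhandryOracle.lean` (D-0014: the named
fact `aaronsonChen2017_thm76_memPPoly` of that file is discharged here as
`aaronsonChen2017_thm76_memPPoly_holds`; this file only adds proofs and the plumbing they need).

**The printed sentence** (S. Aaronson, L. Chen, CCC 2017, arXiv:1612.05903, proof of Thm. 7.6,
last sentence, p. 30; read via `lit read arxiv:1612.05903`, `p0030.txt`): "Finally, note that each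
`f_n` has a polynomial-size circuit, and consequently `O ∈ P/poly`."

**The argument formalised** (Arora–Barak 2009, Def. 6.16 / Thm. 6.18: polynomial-size circuits
absorb polynomial advice, `polyAdvice_subset_PPoly P_subset_PPoly_holds`). We show
`zhandryOracle F ℓ C ∈ P/poly-advice` and REUSE the polynomial-time advice evaluator `ACEval.outF`
of `Literature/Barriers/QuantumAdvantage/PPolyOraclesPPoly.lean`, which decides the sibling encoding
`acLang W` (headers `1^m 0 1^j 0 x`, one table `W m` per level) given the list of level records
(`ACEval.advOf`: tag, block length, key, modulus) as advice (`ACEval.outF_hdr`):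

* the content assignment `C` becomes the table assignment `tables F ℓ C` (`filler ↦ id`,
  `prp k ↦ rawTbl`, `prfmod k a ↦ modTbl`; `IsACTable` by well-formedness), whose level value on
  `{0,1}^{j_n}` is the level function `(C n).fn F ℓ n` (`levelValue_tables`);
* the advice for length `m` is the pair of the block-length table `⟨1^{j_0}, …, 1^{j_m}⟩`
  (`blockTable`, `j_n = (C n).blockLen ℓ n`) and `ACEval.advOf … m`, of polynomial length
  (`length_adv_le`, from the bounds of `IsEfficientFamily` and `ACEval.length_advOf_le`);
* ONE polynomial-time language (`advLang`, assembled from the tree's `FP` string bricks — pair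
  projections, `List.tail`, `onesFn`, `eqPairFn`, `lenLeFn`, `HashBricks.nthItemFn`, `concatFn` —
  and `ACEval.outF`; no new machine) accepts `⟨w, ⟨T, A⟩⟩` iff either `w` re-encodes as an
  announcement string `ancStr n i` with `i < j_n` (read off item `n` of `T`), or `w` re-encodes
  as a value string `qryStr n x i` with `|x| = j_n` and the evaluator accepts `⟨1^n 0 1^i 0 x, A⟩`,
  i.e. bit `i` of the level-`n` value of `x` is `1` (`mem_zhandryOracle_iff_advLang`).

## References

* [AaronsonChen2017] arXiv:1612.05903, Thm. 7.6 (proof, last sentence, p. 30).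
* [AroraBarak2009] S. Arora, B. Barak, *Computational Complexity* (2009), Def. 6.5, Def. 6.16,
  Thm. 6.18 (`P/poly` and advice), Thm. 6.6 (`P ⊆ P/poly`), §1.3 (closure of polynomial time).
-/

noncomputable section

namespace Literature.Computability.Cryptography

open _root_.Computability Complexity Polynomial
open Literature.Computability.Complexity.Brick Literature.Computability.Complexity.OracleCompose
  Literature.Computability.Complexity.HashBricks Literature.Computability.Complexity.PRelSigma
open Literature.Barriers.QuantumAdvantage

namespace ZhandryPPoly

variable {F : FunctionEnsemble} {κ ℓ : ℕ → ℕ}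

/-! ### The table assignment of a content assignment -/

/-- The level table of a content: the identity for the filler, `rawTbl` for `PRP^raw_k`, `modTbl`
for `PRF^mod_{(k,a)}` (the tables of `PPolyOraclesThm76.lean`).
[cite: AaronsonChen2017, Thm. 7.6 (proof, p. 30)] -/
def tbl (F : FunctionEnsemble) (ℓ : ℕ → ℕ) (n : ℕ) : LevelContent → Tbl ℓ n
  | .filler => id
  | .prp k => rawTbl F ℓ n k
  | .prfmod k a => modTbl F ℓ n k a

/-- The table assignment of a content assignment.
[cite: AaronsonChen2017, Thm. 7.6 (proof, p. 30)] -/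
def tables (F : FunctionEnsemble) (ℓ : ℕ → ℕ) (C : ℕ → LevelContent) : Tables ℓ :=
  fun n => tbl F ℓ n (C n)

/-- A well-formed content gives an `IsACTable` table.
[cite: AaronsonChen2017, Thm. 7.6 (proof, p. 30)] -/
theorem isACTable_tbl {n : ℕ} {c : LevelContent} (hc : c.WellFormed κ ℓ n) :
    IsACTable F κ ℓ n (tbl F ℓ n c) := by
  cases c with
  | filler => exact Or.inl rfl
  | prp k => exact Or.inr (Or.inl ⟨k, hc, rfl⟩)
  | prfmod k a => exact Or.inr (Or.inr ⟨k, a, hc.1, hc.2, rfl⟩)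

/-- The block length of a level is at most `n + ℓ n`. [folklore] -/
theorem blockLen_le (ℓ : ℕ → ℕ) (n : ℕ) (c : LevelContent) : c.blockLen ℓ n ≤ n + ℓ n := by
  cases c <;> simp

/-- The level function is length-preserving on its block length (length discipline of `F`).
[cite: AaronsonChen2017, §7.2 (p. 29)] -/
theorem length_fn (hF : IsEfficientFamily F κ ℓ ℓ) {n : ℕ} {c : LevelContent}
    (hc : c.WellFormed κ ℓ n) {x : List Bool} (hx : x.length = c.blockLen ℓ n) :
    (c.fn F ℓ n x).length = c.blockLen ℓ n := by
  cases c with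
  | filler => simpa using hx
  | prp k => exact hF.2.2 n k x hc hx
  | prfmod k a => exact length_prfMod hF n hc.1 a x

/-- **The level value of the table assignment is the level function** on arguments of the block
length. [cite: AaronsonChen2017, Thm. 7.6 (proof, p. 30)] -/
theorem levelValue_tables (hF : IsEfficientFamily F κ ℓ ℓ) (C : ℕ → LevelContent) {n : ℕ}
    (hc : (C n).WellFormed κ ℓ n) {x : List Bool} (hx : x.length = (C n).blockLen ℓ n) :
    levelValue (tables F ℓ C) n x = (C n).fn F ℓ n x := by
  have hW : tables F ℓ C n = tbl F ℓ n (C n) := rfl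
  revert hW hc hx
  generalize C n = c
  intro hc hx hW
  cases c with
  | filler =>
    rw [LevelContent.fn_filler, id]
    unfold levelValue
    split_ifs with h
    · rw [hW]; rfl
    · rfl
  | prp k =>
    have hk : k.length = κ n := hc
    have hxl : x.length = ℓ n := hx
    have hFl : (F n k x).length = ℓ n := hF.2.2 n k x hk hxl
    unfold levelValue
    rw [dif_pos hxl, hW]
    simp [tbl, rawTbl, toTbl, hFl]
  | prfmod k a =>
    have hk : k.length = κ n := hc.1
    have hxl : x.length = ℓ n := hx
    have hFl : (prfMod F ℓ n k a x).length = ℓ n := length_prfMod hF n hk a x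
    unfold levelValue
    rw [dif_pos hxl, hW]
    simp [tbl, modTbl, toTbl, hFl]

/-! ### The advice: block lengths and level records -/

/-- The block-length table for length `m`: the coded list `⟨1^{j_0}, …, 1^{j_m}⟩`,
`j_n = (C n).blockLen ℓ n`. [cite: AroraBarak2009, Def. 6.16] -/
def blockTable (ℓ : ℕ → ℕ) (C : ℕ → LevelContent) (m : ℕ) : List Bool :=
  body ((List.range (m + 1)).map fun n => ones ((C n).blockLen ℓ n))

/-- **The advice for length `m`**: the block-length table and the level records of `ACEval.advOf`.
[cite: AroraBarak2009, Def. 6.16] -/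
def adv (F : FunctionEnsemble) (κ ℓ : ℕ → ℕ) (C : ℕ → LevelContent) (m : ℕ) : List Bool :=
  boolPair (blockTable ℓ C m) (ACEval.advOf F κ ℓ (tables F ℓ C) m)

/-- Item `n ≤ m` of the block-length table. [folklore] -/
theorem nthItemFn_blockTable {ℓ : ℕ → ℕ} (C : ℕ → LevelContent) {n m : ℕ} (h : n ≤ m) :
    nthItemFn (boolPair (ones n) (blockTable ℓ C m)) = ones ((C n).blockLen ℓ n) := by
  rw [blockTable, nthItemFn_body, List.getD_eq_getElem _ _ (by simpa using Nat.lt_succ_of_le h)]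
  simp [List.getElem_map, List.getElem_range]

/-- The block-length table has polynomial length. [cite: AroraBarak2009, Def. 6.16] -/
theorem length_blockTable_le (C : ℕ → LevelContent) {q : Polynomial ℕ}
    (hq : ∀ n, κ n ≤ q.eval n ∧ ℓ n ≤ q.eval n ∧ ℓ n ≤ q.eval n) (m : ℕ) :
    (blockTable ℓ C m).length ≤ ((X + 1) * (2 * X + 2 * q + 2)).eval m := by
  rw [blockTable, ACEval.length_body, List.map_map]
  have hterm : ∀ n ∈ List.range (m + 1),
      ((fun r : List Bool => 2 * r.length + 2) ∘ fun n => ones ((C n).blockLen ℓ n)) n ≤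
        2 * m + 2 * q.eval m + 2 := by
    intro n hn
    have hnm : n ≤ m := Nat.lt_succ_iff.1 (List.mem_range.1 hn)
    have h1 : ℓ n ≤ q.eval m := (hq n).2.1.trans (TM2Iter.eval_mono q hnm)
    have h2 := blockLen_le ℓ n (C n)
    simp only [Function.comp_apply, List.length_replicate]
    omega
  have hev : ((X + 1) * (2 * X + 2 * q + 2)).eval m = (m + 1) * (2 * m + 2 * q.eval m + 2) := by
    simp only [eval_mul, eval_add, eval_X, eval_one, eval_ofNat]
  rw [hev]
  calc ((List.range (m + 1)).map
        ((fun r : List Bool => 2 * r.length + 2) ∘ fun n => ones ((C n).blockLen ℓ n))).sum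
      ≤ ((List.range (m + 1)).map fun _ => 2 * m + 2 * q.eval m + 2).sum :=
        List.sum_le_sum (fun n hn => hterm n hn)
    _ = (m + 1) * (2 * m + 2 * q.eval m + 2) := by
        rw [List.map_const', List.sum_replicate, List.length_range, smul_eq_mul]

/-- The size polynomial of the advice. [folklore] -/
def advPoly (q : Polynomial ℕ) : Polynomial ℕ :=
  2 * ((X + 1) * (2 * X + 2 * q + 2)) + 2 + (X + 1) * (10 * q + 26)

/-- **The advice has polynomial length.** [cite: AroraBarak2009, Def. 6.16] -/
theorem length_adv_le (C : ℕ → LevelContent) (hC : ∀ n, (C n).WellFormed κ ℓ n) {q : Polynomial ℕ}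
    (hq : ∀ n, κ n ≤ q.eval n ∧ ℓ n ≤ q.eval n ∧ ℓ n ≤ q.eval n) (m : ℕ) :
    (adv F κ ℓ C m).length ≤ (advPoly q).eval m := by
  have h1 := length_blockTable_le (ℓ := ℓ) C hq m
  have h2 := length_advOf_le (F := F) (κ := κ) (tables F ℓ C)
    (fun n => isACTable_tbl (hC n)) hq m
  rw [adv, length_boolPair, advPoly, eval_add, eval_add, eval_mul]
  simp only [eval_ofNat]
  omega

/-! ### The polynomial-time language: parsing bricks -/

/-- The query `w` of `z = ⟨w, ⟨T, A⟩⟩`. [folklore] -/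
def qW : List Bool → List Bool := fstF
/-- The block-length table `T`. [folklore] -/
def qT : List Bool → List Bool := fstF ∘ sndF
/-- The record advice `A`. [folklore] -/
def qA : List Bool → List Bool := sndF ∘ sndF
/-- The level prefix `u` of `w = ⟨u, rest⟩`. [folklore] -/
def qU : List Bool → List Bool := fstF ∘ qW
/-- The rest after its tag bit: `r = tail rest`. [folklore] -/
def qR : List Bool → List Bool := List.tail ∘ sndF ∘ qW
/-- The argument `x` of `r = ⟨x, v⟩`. [folklore] -/
def qX : List Bool → List Bool := fstF ∘ qR
/-- The bit-index block `v` of `r = ⟨x, v⟩`. [folklore] -/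
def qV : List Bool → List Bool := sndF ∘ qR
/-- Item `|u|` of `T`: the block length `1^{j_{|u|}}`. [folklore] -/
def blkItemF : List Bool → List Bool := nthItemFn ∘ fanoutFn (onesFn ∘ qU) qT
/-- The announcement re-encoding `⟨1^{|u|}, 0 · 1^{|r|}⟩`. [folklore] -/
def reencA : List Bool → List Bool := fanoutFn (onesFn ∘ qU) (List.cons false ∘ onesFn ∘ qR)
/-- The value-string re-encoding `⟨1^{|u|}, 1 · ⟨x, 1^{|v|}⟩⟩`. [folklore] -/
def reencQ : List Bool → List Bool :=
  fanoutFn (onesFn ∘ qU) (List.cons true ∘ fanoutFn qX (onesFn ∘ qV))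
/-- The header `1^{|u|} 0 1^{|v|} 0 x` of the sibling encoding `acLang`. [folklore] -/
def hdrQ : List Bool → List Bool :=
  concatFn ∘ fanoutFn (onesFn ∘ qU)
    (List.cons false ∘ concatFn ∘ fanoutFn (onesFn ∘ qV) (List.cons false ∘ qX))
/-- `[|r| + 1 ≤ |item|]`: the announced index is below the block length. [folklore] -/
def ltOk : List Bool → List Bool := lenLeFn X ∘ fanoutFn blkItemF (List.cons true ∘ qR)
/-- `[1^{|x|} = item]`: the argument has the block length. [folklore] -/
def lenOk : List Bool → List Bool := eqPairFn ∘ fanoutFn (onesFn ∘ qX) blkItemF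
/-- The evaluator of the sibling file on `⟨header, A⟩`. [folklore] -/
def evQ (F : FunctionEnsemble) : List Bool → List Bool := ACEval.outF F ∘ fanoutFn hdrQ qA

/-- `qW ∈ FP`. [folklore] -/
theorem qW_mem_FP : qW ∈ FP := fstF_mem_FP
/-- `qT ∈ FP`. [folklore] -/
theorem qT_mem_FP : qT ∈ FP := comp_mem_FP fstF_mem_FP sndF_mem_FP
/-- `qA ∈ FP`. [folklore] -/
theorem qA_mem_FP : qA ∈ FP := comp_mem_FP sndF_mem_FP sndF_mem_FP
/-- `qU ∈ FP`. [folklore] -/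
theorem qU_mem_FP : qU ∈ FP := comp_mem_FP fstF_mem_FP qW_mem_FP
/-- `qR ∈ FP`. [folklore] -/
theorem qR_mem_FP : qR ∈ FP := comp_mem_FP tail_mem_FP (comp_mem_FP sndF_mem_FP qW_mem_FP)
/-- `qX ∈ FP`. [folklore] -/
theorem qX_mem_FP : qX ∈ FP := comp_mem_FP fstF_mem_FP qR_mem_FP
/-- `qV ∈ FP`. [folklore] -/
theorem qV_mem_FP : qV ∈ FP := comp_mem_FP sndF_mem_FP qR_mem_FP
/-- `blkItemF ∈ FP`. [folklore] -/
theorem blkItemF_mem_FP : blkItemF ∈ FP :=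
  comp_mem_FP nthItemFn_mem_FP (fanoutFn_mem_FP (comp_mem_FP onesFn_mem_FP qU_mem_FP) qT_mem_FP)
/-- `reencA ∈ FP`. [folklore] -/
theorem reencA_mem_FP : reencA ∈ FP :=
  fanoutFn_mem_FP (comp_mem_FP onesFn_mem_FP qU_mem_FP)
    (comp_mem_FP (cons_mem_FP false) (comp_mem_FP onesFn_mem_FP qR_mem_FP))
/-- `reencQ ∈ FP`. [folklore] -/
theorem reencQ_mem_FP : reencQ ∈ FP :=
  fanoutFn_mem_FP (comp_mem_FP onesFn_mem_FP qU_mem_FP)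
    (comp_mem_FP (cons_mem_FP true)
      (fanoutFn_mem_FP qX_mem_FP (comp_mem_FP onesFn_mem_FP qV_mem_FP)))
/-- `hdrQ ∈ FP`. [folklore] -/
theorem hdrQ_mem_FP : hdrQ ∈ FP :=
  comp_mem_FP concatFn_mem_FP (fanoutFn_mem_FP (comp_mem_FP onesFn_mem_FP qU_mem_FP)
    (comp_mem_FP (cons_mem_FP false) (comp_mem_FP concatFn_mem_FP
      (fanoutFn_mem_FP (comp_mem_FP onesFn_mem_FP qV_mem_FP)
        (comp_mem_FP (cons_mem_FP false) qX_mem_FP)))))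
/-- `ltOk ∈ FP`. [folklore] -/
theorem ltOk_mem_FP : ltOk ∈ FP :=
  comp_mem_FP (lenLeFn_mem_FP X)
    (fanoutFn_mem_FP blkItemF_mem_FP (comp_mem_FP (cons_mem_FP true) qR_mem_FP))
/-- `lenOk ∈ FP`. [folklore] -/
theorem lenOk_mem_FP : lenOk ∈ FP :=
  comp_mem_FP eqPairFn_mem_FP
    (fanoutFn_mem_FP (comp_mem_FP onesFn_mem_FP qX_mem_FP) blkItemF_mem_FP)
/-- `evQ F ∈ FP` for an efficiently computable `F`. [cite: AroraBarak2009, §1.3] -/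
theorem evQ_mem_FP (hF : IsEfficientFamily F κ ℓ ℓ) : evQ F ∈ FP :=
  comp_mem_FP (ACEval.outF_mem_FP hF) (fanoutFn_mem_FP hdrQ_mem_FP qA_mem_FP)

/-! ### The polynomial-time language -/

/-- **The `P` language of the advice characterisation**: an announcement string whose index is
below the block length of its level, or a value string whose argument has the block length and
whose bit is accepted by the evaluator. [cite: AroraBarak2009, Def. 6.16] -/
def advLang (F : FunctionEnsemble) : Language Bool :=
  (({z | qW z = reencA z} : Language Bool) ⊓ {z | ltOk z = [true]}) ⊔
    (({z | qW z = reencQ z} : Language Bool) ⊓ (({z | lenOk z = [true]} : Language Bool) ⊓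
      {z | evQ F z = [true]}))

/-- Membership in `advLang`. [folklore] -/
theorem mem_advLang_iff (F : FunctionEnsemble) (z : List Bool) :
    z ∈ advLang F ↔ (qW z = reencA z ∧ ltOk z = [true]) ∨
      (qW z = reencQ z ∧ lenOk z = [true] ∧ evQ F z = [true]) :=
  Iff.rfl

/-- **`advLang F ∈ P`.** [cite: AroraBarak2009, §1.3] -/
theorem advLang_mem_P (hF : IsEfficientFamily F κ ℓ ℓ) : advLang F ∈ Classes.P :=
  union_mem_P
    (inter_mem_P (setOf_apply_eq_apply_mem_P qW_mem_FP reencA_mem_FP)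
      (setOf_apply_eq_apply_mem_P ltOk_mem_FP (const_mem_FP [true])))
    (inter_mem_P (setOf_apply_eq_apply_mem_P qW_mem_FP reencQ_mem_FP)
      (inter_mem_P (setOf_apply_eq_apply_mem_P lenOk_mem_FP (const_mem_FP [true]))
        (setOf_apply_eq_apply_mem_P (evQ_mem_FP hF) (const_mem_FP [true]))))

/-! ### Semantics of the bricks on `⟨w, ⟨T, A⟩⟩` -/

section Eval

variable (w T A : List Bool)

/-- The query. [folklore] -/
@[simp] theorem qW_apply : qW (boolPair w (boolPair T A)) = w := by simp [qW]
/-- The table. [folklore] -/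
@[simp] theorem qT_apply : qT (boolPair w (boolPair T A)) = T := by simp [qT]
/-- The records. [folklore] -/
@[simp] theorem qA_apply : qA (boolPair w (boolPair T A)) = A := by simp [qA]
/-- The level prefix. [folklore] -/
@[simp] theorem qU_apply : qU (boolPair w (boolPair T A)) = fstF w := by simp [qU, qW]
/-- The rest after the tag bit. [folklore] -/
@[simp] theorem qR_apply : qR (boolPair w (boolPair T A)) = (sndF w).tail := by simp [qR, qW]
/-- The argument. [folklore] -/
@[simp] theorem qX_apply : qX (boolPair w (boolPair T A)) = fstF (sndF w).tail := by
  simp [qX, qR, qW]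
/-- The index block. [folklore] -/
@[simp] theorem qV_apply : qV (boolPair w (boolPair T A)) = sndF (sndF w).tail := by
  simp [qV, qR, qW]
/-- The fetched item. [folklore] -/
@[simp] theorem blkItemF_apply :
    blkItemF (boolPair w (boolPair T A)) = nthItemFn (boolPair (ones (fstF w).length) T) := by
  simp [blkItemF, fanoutFn_apply, onesFn, Complexity.unaryEncodeNat_eq_replicate, qU, qT, qW]
/-- The announcement re-encoding. [folklore] -/
@[simp] theorem reencA_apply : reencA (boolPair w (boolPair T A)) =
    boolPair (ones (fstF w).length) (false :: ones (sndF w).tail.length) := by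
  simp [reencA, fanoutFn_apply, onesFn, Complexity.unaryEncodeNat_eq_replicate, qU, qR, qW]
/-- The value-string re-encoding. [folklore] -/
@[simp] theorem reencQ_apply : reencQ (boolPair w (boolPair T A)) =
    boolPair (ones (fstF w).length)
      (true :: boolPair (fstF (sndF w).tail) (ones (sndF (sndF w).tail).length)) := by
  simp [reencQ, fanoutFn_apply, onesFn, Complexity.unaryEncodeNat_eq_replicate, qU, qX, qV, qR, qW]
/-- The header. [folklore] -/
@[simp] theorem hdrQ_apply : hdrQ (boolPair w (boolPair T A)) =
    hdr (fstF w).length (sndF (sndF w).tail).length (fstF (sndF w).tail) := by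
  simp [hdrQ, hdr, fanoutFn_apply, onesFn, Complexity.unaryEncodeNat_eq_replicate, qU, qX, qV, qR,
    qW, concatFn_boolPair]
/-- The index test. [folklore] -/
@[simp] theorem ltOk_apply : ltOk (boolPair w (boolPair T A)) =
    [decide ((sndF w).tail.length + 1 ≤
      (nthItemFn (boolPair (ones (fstF w).length) T)).length)] := by
  rw [ltOk, Function.comp_apply, fanoutFn_apply, blkItemF_apply, lenLeFn_boolPair]
  simp [qR, qW]
/-- The length test. [folklore] -/
@[simp] theorem lenOk_apply : lenOk (boolPair w (boolPair T A)) =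
    [decide (ones (fstF (sndF w).tail).length =
      nthItemFn (boolPair (ones (fstF w).length) T))] := by
  rw [lenOk, Function.comp_apply, fanoutFn_apply, blkItemF_apply, eqPairFn_boolPair]
  simp [qX, qR, qW, onesFn, Complexity.unaryEncodeNat_eq_replicate]
/-- The evaluator call. [folklore] -/
@[simp] theorem evQ_apply : evQ F (boolPair w (boolPair T A)) =
    ACEval.outF F
      (boolPair (hdr (fstF w).length (sndF (sndF w).tail).length (fstF (sndF w).tail)) A) := by
  rw [evQ, Function.comp_apply, fanoutFn_apply, hdrQ_apply, qA_apply]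

end Eval

/-- `ancStr` through `ones`. [folklore] -/
theorem ancStr_eq (n i : ℕ) : ancStr n i = boolPair (ones n) (false :: ones i) := by
  rw [ancStr, Complexity.unaryEncodeNat_eq_replicate, Complexity.unaryEncodeNat_eq_replicate]

/-- `qryStr` through `ones`. [folklore] -/
theorem qryStr_eq (n : ℕ) (x : List Bool) (i : ℕ) :
    qryStr n x i = boolPair (ones n) (true :: boolPair x (ones i)) := by
  rw [qryStr, Complexity.unaryEncodeNat_eq_replicate, Complexity.unaryEncodeNat_eq_replicate]

/-! ### The advice characterisation of the oracle -/

/-- **`w ∈ zhandryOracle F ℓ C` iff `⟨w, adv |w|⟩ ∈ advLang F`.**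
[cite: AaronsonChen2017, Thm. 7.6 (proof, p. 30)] [cite: AroraBarak2009, Def. 6.16] -/
theorem mem_zhandryOracle_iff_advLang (hF : IsEfficientFamily F κ ℓ ℓ) {C : ℕ → LevelContent}
    (hC : ∀ n, (C n).WellFormed κ ℓ n) (w : List Bool) :
    w ∈ zhandryOracle F ℓ C ↔ boolPair w (adv F κ ℓ C w.length) ∈ advLang F := by
  have hW : ∀ n, IsACTable F κ ℓ n (tables F ℓ C n) := fun n => isACTable_tbl (hC n)
  rw [mem_advLang_iff, adv]
  constructor
  · rintro ⟨n, hn⟩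
    rcases hn with ⟨i, hi, rfl⟩ | ⟨x, i, hx, hi, hb, rfl⟩
    · -- an announcement string `ancStr n i`, `i < j_n`
      left
      have hlen : n ≤ (ancStr n i).length := by
        rw [ancStr_eq, length_boolPair, List.length_replicate]; omega
      rw [qW_apply, reencA_apply, ltOk_apply, ancStr_eq]
      refine ⟨?_, ?_⟩
      · simp only [fstF_boolPair, sndF_boolPair, List.tail_cons, List.length_replicate]
      · simp only [fstF_boolPair, sndF_boolPair, List.tail_cons, List.length_replicate]
        rw [← ancStr_eq, nthItemFn_blockTable C hlen, List.length_replicate]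
        simpa using hi
    · -- a value string `qryStr n x i`, `|x| = j_n`, `i < j_n`, bit `i` of `f_n x` set
      right
      have hlen : n ≤ (qryStr n x i).length := by
        rw [qryStr_eq, length_boolPair, List.length_replicate]; omega
      rw [qW_apply, reencQ_apply, lenOk_apply, evQ_apply, qryStr_eq]
      refine ⟨?_, ?_, ?_⟩
      · simp only [fstF_boolPair, sndF_boolPair, List.tail_cons, List.length_replicate]
      · simp only [fstF_boolPair, sndF_boolPair, List.tail_cons, List.length_replicate]
        rw [← qryStr_eq, nthItemFn_blockTable C hlen, hx]
        simp
      · simp only [fstF_boolPair, sndF_boolPair, List.tail_cons, List.length_replicate]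
        rw [← qryStr_eq, ACEval.outF_hdr (tables F ℓ C) i x hF (hW n) hlen,
          levelValue_tables hF C (hC n) hx, hb]
  · rintro (⟨h1, h2⟩ | ⟨h3, h4, h5⟩)
    · -- accepted as an announcement
      rw [qW_apply, reencA_apply] at h1
      rw [ltOk_apply] at h2
      set n := (fstF w).length with hn
      set i := (sndF w).tail.length with hi
      have hw : w = ancStr n i := by rw [ancStr_eq]; exact h1
      have hlen : n ≤ w.length := by
        rw [h1, length_boolPair, List.length_replicate]; omega
      rw [nthItemFn_blockTable C hlen, List.length_replicate] at h2
      have hlt : i < (C n).blockLen ℓ n := by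
        have := of_decide_eq_true (List.cons.inj h2).1
        omega
      exact ⟨n, Or.inl ⟨i, hlt, hw⟩⟩
    · -- accepted as a value string
      rw [qW_apply, reencQ_apply] at h3
      rw [lenOk_apply] at h4
      rw [evQ_apply] at h5
      set n := (fstF w).length with hn
      set x := fstF (sndF w).tail with hxdef
      set i := (sndF (sndF w).tail).length with hi
      have hw : w = qryStr n x i := by rw [qryStr_eq]; exact h3
      have hlen : n ≤ w.length := by
        rw [h3, length_boolPair, List.length_replicate]; omega
      rw [nthItemFn_blockTable C hlen] at h4
      have hx : x.length = (C n).blockLen ℓ n := by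
        have h := congrArg List.length (of_decide_eq_true (List.cons.inj h4).1)
        rwa [List.length_replicate, List.length_replicate] at h
      rw [ACEval.outF_hdr (tables F ℓ C) i x hF (hW n) hlen, levelValue_tables hF C (hC n) hx]
        at h5
      have hb : ((C n).fn F ℓ n x).getD i false = true := (List.cons.inj h5).1
      have hlt : i < (C n).blockLen ℓ n := by
        rw [← length_fn hF (hC n) hx]
        by_contra hge
        rw [List.getD_eq_default _ _ (not_lt.1 hge)] at hb
        exact Bool.false_ne_true hb
      exact ⟨n, Or.inr ⟨x, i, hx, hlt, hb, hw⟩⟩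

/-- **`zhandryOracle F ℓ C ∈ P/poly-advice`** for an efficiently computable `F` and a
well-formed content assignment.
[cite: AaronsonChen2017, Thm. 7.6 (proof, p. 30)] [cite: AroraBarak2009, Def. 6.16] -/
theorem zhandryOracle_mem_polyAdvice_P (hF : IsEfficientFamily F κ ℓ ℓ) {C : ℕ → LevelContent}
    (hC : ∀ n, (C n).WellFormed κ ℓ n) : zhandryOracle F ℓ C ∈ polyAdvice Classes.P := by
  obtain ⟨q, hq⟩ := hF.2.1
  exact ⟨advLang F, advLang_mem_P hF, adv F κ ℓ C, advPoly q, length_adv_le C hC hq,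
    mem_zhandryOracle_iff_advLang hF hC⟩

end ZhandryPPoly

/-- **Aaronson–Chen 2017, proof of Thm. 7.6, last sentence: "each `f_n` has a polynomial-size
circuit, and consequently `O ∈ P/poly`"** — discharge of the named fact
`aaronsonChen2017_thm76_memPPoly`: the oracle `zhandryOracle F ℓ C` of an efficiently computable
family under a well-formed content assignment is in `P/poly` (polynomial advice — the keys, moduli
and block lengths of the levels — over a polynomial-time evaluator, absorbed into circuits by
`P ⊆ P/poly`, Arora–Barak Thm. 6.6/6.18).
[cite: AaronsonChen2017, Thm. 7.6 (proof, last sentence, p. 30)]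
[cite: AroraBarak2009, Thm. 6.18] -/
theorem aaronsonChen2017_thm76_memPPoly_holds : aaronsonChen2017_thm76_memPPoly :=
  fun _F _κ _ℓ hF _C hC =>
    polyAdvice_subset_PPoly P_subset_PPoly_holds (ZhandryPPoly.zhandryOracle_mem_polyAdvice_P hF hC)

end Literature.Computability.Cryptography

end
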